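import Literature.AnabelianGeometry.SemiGraphs.TemperedHbddOfNoCore
import Literature.AnabelianGeometry.SemiGraphs.TemperedTripleConjugateCriterion
import HarnessLib

/-!
# [SemiAnbd] Thm 3.7 (ii)–(iv) at every countable `𝒢` WITHOUT AN INFINITELY-BRANCHING CORE: «precisely two
# verticial hosts», the triple-conjugate criterion, normalisers, and «edge-like subgroups are commensurably terminal»

Mochizuki, *Semi-graphs of anabelioids*, Publ. RIMS **42** (2006), §3, Theorem 3.7 (ii)–(iv), manuscript
pp. 40–41 ("If a nontrivial compact subgroup of `π₁^temp(𝒢)` is contained in more than one verticial subgroup, then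
it is contained in precisely two verticial subgroups … [and] in the image of some `π̂₁(𝒢_e)`"; "the nontrivial
intersections of two distinct maximal compact subgroups … are precisely the edge-like subgroups") with §5 p. 65
(commensurators) [cite: MochizukiSemiAnbd2006, Thm 3.7(iii) pp.40-41].

PROOF-ONLY (cell abc-iut, block F, seat abc-iut-f-176 gen 4; no definition, no named fact, no custody file
touched).  The locally finite package of abc-iut-w6-d062 (`TemperedConj2OfLocallyFinite.lean`) and abc-iut-f-172
(`TemperedTripleConjugateCriterion.lean`) rests on ONE input, the adjacency clause (FIX∞).hadj at the canonical
tower; `TemperedHbddOfNoCore.lean` supplies that clause at every graph WITHOUT CORE (`hadj_temperedPiChart_of_noCore`: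
every non-empty set `S` of vertices has a member with only finitely many branches whose edge's other branch abuts
`S` — every locally finite graph, every TAME graph, every star of any valence, …).  This file re-runs the package on
that input, verbatim except for the source of `hadj`; vertices of INFINITE valence are now allowed:

* **`compactInTwoVerticial_of_noCore`** — Thm 3.7 (iii), second and third sentences (the second conjunct of the
  per-graph named fact `CompactInVerticialAt 𝒢`, F-1732 family), every chart: a compact `C ≠ 1` in two distinct
  verticial subgroups lies in precisely these two and in an edge-like subgroup of a closed edge
  (abc-iut-w4-d080's `VerticialLevelData.conj2_of_fixedSystems`); `compactInVerticialAt_iff_exists_verticial_of_noCore`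
  — at such `𝒢` the named fact is equivalent to its existence sentence;
* **`mem_verticial_of_le_conj_conj_of_noCore`** — the triple-conjugate criterion (`K ≤ H ∩ gHg⁻¹ ∩ g²Hg⁻²`,
  `K ≠ 1` compact, `H` verticial ⇒ `g ∈ H`; abc-iut-f-172's `VerticialLevelData.mem_of_le_conj_conj`),
  `mem_verticial_of_inf_conj_conj_ne_bot_of_noCore`, **`normalizer_le_verticial_of_noCore`**;
* **`commensurator_le_verticial_of_mem_edgeLikeSubgroups_of_noCore`**,
  **`commensurator_eq_of_mem_edgeLikeSubgroups_of_noCore`** (edge-like subgroups are commensurably terminal,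
  `C(L) = L`, with abc-iut-f-173's F-1703 `edgeLikeIsInfVerticialAt_holds`),
  `eq_of_commensurable_of_mem_edgeLikeSubgroups_of_noCore`, `smul_eq_self_of_mem_commensurator_of_mem_edgeLikeSubgroups_of_noCore`.

Honest framing: OUR typed tempered fundamental groups; graphs WITH an infinitely-branching core excluded; the existence
sentence of Thm 3.7 (iii) is not asserted (it fails at `𝒢_θ`); nothing here bears on [IUTchIII] Cor. 3.12; typed ≠
proved elsewhere.
-/

namespace Literature.AnabelianGeometry.SemiGraphs

namespace ProfiniteSemiGraph

open CategoryTheory Topology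
open scoped Pointwise

universe u
variable (𝒢 : ProfiniteSemiGraph.{u})

/-! ### Thm 3.7 (iii), second and third sentences -/

/-- **[SemiAnbd] Theorem 3.7 (iii), second and third sentences, at every countable `𝒢` without core and every
chart** — "if a nontrivial compact subgroup of `π₁^temp(𝒢)` is contained in more than one verticial subgroup, then
it is contained in precisely two verticial subgroups … [and] in the image of some `π̂₁(𝒢_e)`" (`e` a closed edge):
the second conjunct of `CompactInVerticialAt 𝒢`, with NO hypothesis beyond those of Thm 3.7 and the absence of an
infinitely-branching core in `𝔾` (abc-iut-w4-d080's `conj2_of_fixedSystems` at the transported level data, fed by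
`hadj_temperedPiChart_of_noCore`). [cite: MochizukiSemiAnbd2006, Thm 3.7(iii) pp.40-41] -/
theorem compactInTwoVerticial_of_noCore (h37 : 𝒢.Thm37Hypotheses)
    (hNC : ∀ S : Set 𝒢.graph.Vertex, S.Nonempty → ∃ w ∈ S,
      {b : 𝒢.graph.Branch | 𝒢.graph.abuts b = some w ∧ ∃ b', b' ≠ b ∧ 𝒢.graph.edgeOf b' = 𝒢.graph.edgeOf b ∧
        ∃ w' ∈ S, 𝒢.graph.abuts b' = some w'}.Finite)
    (c : TemperedPiChart 𝒢) (C : Subgroup c.G) (hCc : IsCompact (C : Set c.G)) (hC : C ≠ ⊥)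
    {v₁ v₂ : 𝒢.graph.Vertex} {H₁ H₂ : Subgroup c.G} (hH₁ : H₁ ∈ verticialSubgroups c v₁)
    (hH₂ : H₂ ∈ verticialSubgroups c v₂) (hne : H₁ ≠ H₂) (hC₁ : C ≤ H₁) (hC₂ : C ≤ H₂) :
    (∀ (v₃ : 𝒢.graph.Vertex) (H₃ : Subgroup c.G), H₃ ∈ verticialSubgroups c v₃ → C ≤ H₃ →
        H₃ = H₁ ∨ H₃ = H₂) ∧
      ∃ (e : 𝒢.graph.Edge) (L : Subgroup c.G), 𝒢.graph.IsClosedEdge e ∧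
        L ∈ edgeLikeSubgroups c e ∧ C ≤ L := by
  obtain ⟨φ, ψ, hψφ, hφψ, hφ, hψ⟩ :=
    TemperedPiChart.exists_compatIso (𝒢.temperedPiChart h37.toProp36Hypotheses) c
  let D₀ := verticialLevelData_temperedPiChart (h36 := h37.toProp36Hypotheses)
  let D : VerticialLevelData.{0} 𝒢 c := D₀.transport φ ψ hψφ hφψ
    (fun v H => mem_verticialSubgroups_iff_map φ hφ ψ hφψ hψ H)
    (fun e L => mem_edgeLikeSubgroups_iff_map φ hφ ψ hφψ hψ L)
  exact D.conj2_of_fixedSystems verticialDistinct_holds h37 C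
    (D₀.hadj_transport φ ψ hψφ hφψ _ _
      (fun C' hC'c hC' x x' hx hx' hfx hfx' j hne' =>
        𝒢.hadj_temperedPiChart_of_noCore h37 hNC C' hC'c hC' x x' hx hx' hfx hfx' j hne') C hCc hC)
    hH₁ hH₂ hne hC₁ hC₂

/-- **At a countable `𝒢` without core, `CompactInVerticialAt 𝒢` is EQUIVALENT to its existence sentence** ("every
compact subgroup … is contained in at least one verticial subgroup", p. 40), the uniqueness / edge conjunct being
`compactInTwoVerticial_of_noCore`. [cite: MochizukiSemiAnbd2006, Thm 3.7(iii) pp.40-41] -/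
theorem compactInVerticialAt_iff_exists_verticial_of_noCore
    (hNC : ∀ S : Set 𝒢.graph.Vertex, S.Nonempty → ∃ w ∈ S,
      {b : 𝒢.graph.Branch | 𝒢.graph.abuts b = some w ∧ ∃ b', b' ≠ b ∧ 𝒢.graph.edgeOf b' = 𝒢.graph.edgeOf b ∧
        ∃ w' ∈ S, 𝒢.graph.abuts b' = some w'}.Finite) :
    CompactInVerticialAt 𝒢 ↔
      (𝒢.Thm37Hypotheses → ∀ (c : TemperedPiChart 𝒢) (C : Subgroup c.G), IsCompact (C : Set c.G) →
        ∃ (v : 𝒢.graph.Vertex) (H : Subgroup c.G), H ∈ verticialSubgroups c v ∧ C ≤ H) :=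
  ⟨fun h h37 c C hCc => (h h37 c C hCc).1,
    fun h h37 c C hCc => ⟨h h37 c C hCc, fun hC _ _ _ _ hH₁ hH₂ hne hC₁ hC₂ =>
      𝒢.compactInTwoVerticial_of_noCore h37 hNC c C hCc hC hH₁ hH₂ hne hC₁ hC₂⟩⟩

/-! ### The triple-conjugate criterion and normalisers -/

/-- **TRIPLE-CONJUGATE CRITERION at every countable `𝒢` without core, every chart**: if a compact subgroup `K ≠ 1`
of `π₁^temp(𝒢)` lies in a verticial subgroup `H`, in `gHg⁻¹` and in `g²Hg⁻²`, then `g ∈ H` (abc-iut-f-172's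
`VerticialLevelData.mem_of_le_conj_conj` with (FIX∞).hadj from `hadj_temperedPiChart_of_noCore`, transported).
[cite: MochizukiSemiAnbd2006, Thm 3.7(iv) p.41] -/
theorem mem_verticial_of_le_conj_conj_of_noCore (h37 : 𝒢.Thm37Hypotheses)
    (hNC : ∀ S : Set 𝒢.graph.Vertex, S.Nonempty → ∃ w ∈ S,
      {b : 𝒢.graph.Branch | 𝒢.graph.abuts b = some w ∧ ∃ b', b' ≠ b ∧ 𝒢.graph.edgeOf b' = 𝒢.graph.edgeOf b ∧
        ∃ w' ∈ S, 𝒢.graph.abuts b' = some w'}.Finite)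
    (c : TemperedPiChart 𝒢) {v : 𝒢.graph.Vertex} {H : Subgroup c.G}
    (hH : H ∈ verticialSubgroups c v) (K : Subgroup c.G) (hKc : IsCompact (K : Set c.G)) (hK : K ≠ ⊥)
    (hKH : K ≤ H) (g : c.G) (hKg : ∀ k ∈ K, ∃ h ∈ H, g * h * g⁻¹ = k)
    (hKg₂ : ∀ k ∈ K, ∃ h ∈ H, (g * g) * h * (g * g)⁻¹ = k) : g ∈ H := by
  obtain ⟨φ, ψ, hψφ, hφψ, hφ, hψ⟩ :=
    TemperedPiChart.exists_compatIso (𝒢.temperedPiChart h37.toProp36Hypotheses) c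
  let D₀ := verticialLevelData_temperedPiChart (h36 := h37.toProp36Hypotheses)
  let D : VerticialLevelData.{0} 𝒢 c := D₀.transport φ ψ hψφ hφψ
    (fun v H => mem_verticialSubgroups_iff_map φ hφ ψ hφψ hψ H)
    (fun e L => mem_edgeLikeSubgroups_iff_map φ hφ ψ hφψ hψ L)
  exact D.mem_of_le_conj_conj verticialDistinct_holds h37 hH K
    (D₀.hadj_transport φ ψ hψφ hφψ _ _
      (fun C' hC'c hC' x x' hx hx' hfx hfx' j hne' =>
        𝒢.hadj_temperedPiChart_of_noCore h37 hNC C' hC'c hC' x x' hx hx' hfx hfx' j hne') K hKc hK)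
    hKH g hKg hKg₂

/-- Conjugation by `g` maps compact subgroups to compact subgroups. [cite: MochizukiSemiAnbd2006, Thm 3.7(i) p.40] -/
private theorem isCompact_map_conj' {G : Type u} [Group G] [TopologicalSpace G] [IsTopologicalGroup G]
    {H : Subgroup G} (hH : IsCompact (H : Set G)) (g : G) :
    IsCompact ((H.map (MulAut.conj g).toMonoidHom : Subgroup G) : Set G) := by
  rw [Subgroup.coe_map]
  exact hH.image (IsTopologicalGroup.continuous_conj g)

/-- **`H ⊓ gHg⁻¹ ⊓ g²Hg⁻² ≠ 1 ⇒ g ∈ H`** for a verticial `H`, at every countable `𝒢` without core, every chart.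
[cite: MochizukiSemiAnbd2006, Thm 3.7(iv) p.41] -/
theorem mem_verticial_of_inf_conj_conj_ne_bot_of_noCore (h37 : 𝒢.Thm37Hypotheses)
    (hNC : ∀ S : Set 𝒢.graph.Vertex, S.Nonempty → ∃ w ∈ S,
      {b : 𝒢.graph.Branch | 𝒢.graph.abuts b = some w ∧ ∃ b', b' ≠ b ∧ 𝒢.graph.edgeOf b' = 𝒢.graph.edgeOf b ∧
        ∃ w' ∈ S, 𝒢.graph.abuts b' = some w'}.Finite)
    (c : TemperedPiChart 𝒢) {v : 𝒢.graph.Vertex} {H : Subgroup c.G}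
    (hH : H ∈ verticialSubgroups c v) (g : c.G)
    (hne : H ⊓ H.map (MulAut.conj g).toMonoidHom ⊓ H.map (MulAut.conj (g * g)).toMonoidHom ≠ ⊥) :
    g ∈ H := by
  haveI := TemperedPiChart.t2Space c
  have hHc : IsCompact (H : Set c.G) := isCompact_of_mem_verticialSubgroups c hH
  set K := H ⊓ H.map (MulAut.conj g).toMonoidHom ⊓ H.map (MulAut.conj (g * g)).toMonoidHom with hKdef
  have hKc : IsCompact (K : Set c.G) := by
    rw [hKdef, Subgroup.coe_inf, Subgroup.coe_inf]
    exact (hHc.inter_right (isCompact_map_conj' hHc g).isClosed).inter_right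
      (isCompact_map_conj' hHc (g * g)).isClosed
  refine 𝒢.mem_verticial_of_le_conj_conj_of_noCore h37 hNC c hH K hKc hne
    (inf_le_left.trans inf_le_left) g (fun k hk => ?_) (fun k hk => ?_)
  · obtain ⟨h, hh, hhk⟩ := (inf_le_left.trans inf_le_right : K ≤ _) hk
    exact ⟨h, hh, hhk⟩
  · obtain ⟨h, hh, hhk⟩ := (inf_le_right : K ≤ _) hk
    exact ⟨h, hh, hhk⟩

/-- **The normaliser of a nontrivial compact subgroup `C` of a verticial subgroup `H` lies in `H`**, at every
countable `𝒢` without core, every chart (triple-conjugate criterion at `K := C`; sharpens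
`centralizer_le_verticial_of_noCore`). [cite: MochizukiSemiAnbd2006, Thm 3.7(iv) p.41] -/
theorem normalizer_le_verticial_of_noCore (h37 : 𝒢.Thm37Hypotheses)
    (hNC : ∀ S : Set 𝒢.graph.Vertex, S.Nonempty → ∃ w ∈ S,
      {b : 𝒢.graph.Branch | 𝒢.graph.abuts b = some w ∧ ∃ b', b' ≠ b ∧ 𝒢.graph.edgeOf b' = 𝒢.graph.edgeOf b ∧
        ∃ w' ∈ S, 𝒢.graph.abuts b' = some w'}.Finite)
    (c : TemperedPiChart 𝒢) (C : Subgroup c.G) (hCc : IsCompact (C : Set c.G)) (hC : C ≠ ⊥)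
    {v : 𝒢.graph.Vertex} {H : Subgroup c.G} (hH : H ∈ verticialSubgroups c v) (hCH : C ≤ H) :
    Subgroup.normalizer (C : Set c.G) ≤ H := by
  intro g hg
  have key : ∀ {a : c.G}, a ∈ Subgroup.normalizer (C : Set c.G) → ∀ x ∈ C, a⁻¹ * x * a ∈ C := by
    intro a ha x hx
    have h := (Subgroup.mem_normalizer_iff.mp ((Subgroup.normalizer (C : Set c.G)).inv_mem ha) x).mp hx
    simpa using h
  refine 𝒢.mem_verticial_of_le_conj_conj_of_noCore h37 hNC c hH C hCc hC hCH g
    (fun k hk => ⟨g⁻¹ * k * g, hCH (key hg k hk), by group⟩)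
    (fun k hk => ⟨(g * g)⁻¹ * k * (g * g),
      hCH (key ((Subgroup.normalizer (C : Set c.G)).mul_mem hg hg) k hk), by group⟩)

/-! ### Edge-like subgroups are commensurably terminal, at graphs without core -/

variable {𝒢}

/-- An element of `g·S` (conjugation action) is `g s g⁻¹`, `s ∈ S`. [cite: MochizukiSemiAnbd2006, §5 p.65] -/
private theorem exists_conj_eq_of_mem_smul' {G : Type u} [Group G] {S : Subgroup G} {g k : G}
    (hk : k ∈ ConjAct.toConjAct g • S) : ∃ s ∈ S, g * s * g⁻¹ = k := by
  rw [Subgroup.mem_smul_pointwise_iff_exists] at hk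
  obtain ⟨s, hs, rfl⟩ := hk
  exact ⟨s, hs, by simp [ConjAct.smul_def]⟩

/-- `g·S` (conjugation action) is compact when `S` is. [cite: MochizukiSemiAnbd2006, Thm 3.7(i) p.40] -/
private theorem isCompact_smul' {G : Type u} [Group G] [TopologicalSpace G] [IsTopologicalGroup G]
    {S : Subgroup G} (hS : IsCompact (S : Set G)) (g : G) :
    IsCompact ((ConjAct.toConjAct g • S : Subgroup G) : Set G) := by
  have hset : ((ConjAct.toConjAct g • S : Subgroup G) : Set G) = (fun x => g * x * g⁻¹) '' (S : Set G) := by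
    ext k
    simp only [SetLike.mem_coe, Set.mem_image]
    constructor
    · intro hk
      obtain ⟨s, hs, hsk⟩ := exists_conj_eq_of_mem_smul' hk
      exact ⟨s, hs, hsk⟩
    · rintro ⟨s, hs, rfl⟩
      exact (Subgroup.mem_smul_pointwise_iff_exists _ _ _).mpr ⟨s, hs, by simp [ConjAct.smul_def]⟩
  rw [hset]
  exact hS.image (IsTopologicalGroup.continuous_conj g)

/-- **The commensurator of an edge-like subgroup lies in each of its verticial hosts**, at every countable `𝒢`
without core, every chart (`K := L ∩ gLg⁻¹ ∩ g²Lg⁻²` has finite index in the infinite compact `L`, triple-conjugate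
criterion). [cite: MochizukiSemiAnbd2006, Thm 3.7(iv) p.41] -/
theorem commensurator_le_verticial_of_mem_edgeLikeSubgroups_of_noCore (h37 : 𝒢.Thm37Hypotheses)
    (hNC : ∀ S : Set 𝒢.graph.Vertex, S.Nonempty → ∃ w ∈ S,
      {b : 𝒢.graph.Branch | 𝒢.graph.abuts b = some w ∧ ∃ b', b' ≠ b ∧ 𝒢.graph.edgeOf b' = 𝒢.graph.edgeOf b ∧
        ∃ w' ∈ S, 𝒢.graph.abuts b' = some w'}.Finite)
    (c : TemperedPiChart 𝒢) {e : 𝒢.graph.Edge} {L : Subgroup c.G}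
    (hL : L ∈ edgeLikeSubgroups c e) {v : 𝒢.graph.Vertex} {H : Subgroup c.G}
    (hH : H ∈ verticialSubgroups c v) (hLH : L ≤ H) :
    Subgroup.Commensurable.commensurator L ≤ H := by
  classical
  haveI := TemperedPiChart.t2Space c
  intro g hg
  have hg₂ : g * g ∈ Subgroup.Commensurable.commensurator L := Subgroup.mul_mem _ hg hg
  have hcomm₁ : Subgroup.Commensurable (ConjAct.toConjAct g • L) L :=
    (Subgroup.Commensurable.commensurator_mem_iff L g).mp hg
  have hcomm₂ : Subgroup.Commensurable (ConjAct.toConjAct (g * g) • L) L :=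
    (Subgroup.Commensurable.commensurator_mem_iff L (g * g)).mp hg₂
  set A : Subgroup c.G := ConjAct.toConjAct g • L with hAdef
  set B : Subgroup c.G := ConjAct.toConjAct (g * g) • L with hBdef
  set K : Subgroup c.G := A ⊓ B ⊓ L with hKdef
  have hLc : IsCompact (L : Set c.G) := isCompact_of_mem_edgeLikeSubgroups c hL
  have hKc : IsCompact (K : Set c.G) := by
    rw [hKdef, Subgroup.coe_inf, Subgroup.coe_inf]
    exact ((isCompact_smul' hLc g).inter_right (isCompact_smul' hLc (g * g)).isClosed).inter_right hLc.isClosed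
  haveI hLinf := infinite_of_mem_edgeLikeSubgroups verticialInjective_holds h37 c hL
  have hidx : (A ⊓ B).relIndex L ≠ 0 := Subgroup.relIndex_inf_ne_zero hcomm₁.1 hcomm₂.1
  have hK : K ≠ ⊥ := by
    intro hbot
    have hdis : Disjoint (A ⊓ B) L := by
      rw [disjoint_iff, ← hKdef]
      exact hbot
    have h0 : (A ⊓ B).relIndex L = 0 := by
      rw [Subgroup.relIndex, Subgroup.subgroupOf_eq_bot.mpr hdis, Subgroup.index_bot]
      exact Nat.card_eq_zero_of_infinite
    exact hidx h0
  refine 𝒢.mem_verticial_of_le_conj_conj_of_noCore h37 hNC c hH K hKc hK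
    (inf_le_right.trans hLH) g (fun k hk => ?_) (fun k hk => ?_)
  · obtain ⟨s, hs, hsk⟩ := exists_conj_eq_of_mem_smul' ((inf_le_left.trans inf_le_left : K ≤ A) hk)
    exact ⟨s, hLH hs, hsk⟩
  · obtain ⟨s, hs, hsk⟩ := exists_conj_eq_of_mem_smul' ((inf_le_left.trans inf_le_right : K ≤ B) hk)
    exact ⟨s, hLH hs, hsk⟩

/-- **EDGE-LIKE SUBGROUPS ARE COMMENSURABLY TERMINAL, `C(L) = L`, at every countable graph of anabelioids without
core satisfying the hypotheses of [SemiAnbd] Thm 3.7 — every chart, WITHOUT Thm 3.7 (iii)** (print: Thm 3.7 (iv)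
p. 41 with §5 p. 65): every edge of a graph is closed and `L ≠ 1`, so abc-iut-f-173's F-1703
`edgeLikeIsInfVerticialAt_holds` writes `L = H₁ ⊓ H₂`; the commensurator lies in both hosts.
[cite: MochizukiSemiAnbd2006, Thm 3.7(iv) p.41] -/
theorem commensurator_eq_of_mem_edgeLikeSubgroups_of_noCore (h37 : 𝒢.Thm37Hypotheses)
    (hG : 𝒢.graph.IsGraph)
    (hNC : ∀ S : Set 𝒢.graph.Vertex, S.Nonempty → ∃ w ∈ S,
      {b : 𝒢.graph.Branch | 𝒢.graph.abuts b = some w ∧ ∃ b', b' ≠ b ∧ 𝒢.graph.edgeOf b' = 𝒢.graph.edgeOf b ∧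
        ∃ w' ∈ S, 𝒢.graph.abuts b' = some w'}.Finite)
    (c : TemperedPiChart 𝒢) {e : 𝒢.graph.Edge} {L : Subgroup c.G} (hL : L ∈ edgeLikeSubgroups c e) :
    Subgroup.Commensurable.commensurator L = L := by
  classical
  obtain ⟨b₁, b₂, hb12, hb₁e, hb₂e, -⟩ := 𝒢.graph.two_branches e
  obtain ⟨w₁, hw₁⟩ := Option.isSome_iff_exists.mp (hG.abuts_isSome b₁)
  obtain ⟨w₂, hw₂⟩ := Option.isSome_iff_exists.mp (hG.abuts_isSome b₂)
  have hclosed : 𝒢.graph.IsClosedEdge e :=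
    hb₁e ▸ SemiGraph.isClosedEdge_of_abuts hb12 rfl (hb₂e.trans hb₁e.symm) hw₁ hw₂
  haveI hLinf := infinite_of_mem_edgeLikeSubgroups verticialInjective_holds h37 c hL
  have hLne : L ≠ ⊥ := by
    intro hb
    rw [hb] at hLinf
    exact not_finite (⊥ : Subgroup c.G)
  obtain ⟨v₁, v₂, H₁, H₂, hH₁, hH₂, -, hLeq⟩ := edgeLikeIsInfVerticialAt_holds 𝒢 h37 c e hclosed L hL hLne
  refine le_antisymm (fun g hg => ?_) (le_commensurator_self L)
  have h1 : g ∈ H₁ := commensurator_le_verticial_of_mem_edgeLikeSubgroups_of_noCore h37 hNC c hL hH₁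
    (hLeq ▸ inf_le_left) hg
  have h2 : g ∈ H₂ := commensurator_le_verticial_of_mem_edgeLikeSubgroups_of_noCore h37 hNC c hL hH₂
    (hLeq ▸ inf_le_right) hg
  rw [hLeq]
  exact ⟨h1, h2⟩

/-- **Commensurable edge-like subgroups are EQUAL, at every countable graph of anabelioids without core satisfying
the hypotheses of Thm 3.7 — every chart, without Thm 3.7 (iii).** [cite: MochizukiSemiAnbd2006, Thm 3.7(iv) p.41] -/
theorem eq_of_commensurable_of_mem_edgeLikeSubgroups_of_noCore (h37 : 𝒢.Thm37Hypotheses)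
    (hG : 𝒢.graph.IsGraph)
    (hNC : ∀ S : Set 𝒢.graph.Vertex, S.Nonempty → ∃ w ∈ S,
      {b : 𝒢.graph.Branch | 𝒢.graph.abuts b = some w ∧ ∃ b', b' ≠ b ∧ 𝒢.graph.edgeOf b' = 𝒢.graph.edgeOf b ∧
        ∃ w' ∈ S, 𝒢.graph.abuts b' = some w'}.Finite)
    (c : TemperedPiChart 𝒢) {e e' : 𝒢.graph.Edge}
    {L L' : Subgroup c.G} (hL : L ∈ edgeLikeSubgroups c e) (hL' : L' ∈ edgeLikeSubgroups c e')
    (hc : Subgroup.Commensurable L L') : L = L' := by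
  rw [← commensurator_eq_of_mem_edgeLikeSubgroups_of_noCore h37 hG hNC c hL,
    ← commensurator_eq_of_mem_edgeLikeSubgroups_of_noCore h37 hG hNC c hL', hc.eq]

/-- **A commensurating element normalises an edge-like subgroup**, at every Thm-3.7 graph without core.
[cite: MochizukiSemiAnbd2006, Thm 3.7(iv) p.41] -/
theorem smul_eq_self_of_mem_commensurator_of_mem_edgeLikeSubgroups_of_noCore
    (h37 : 𝒢.Thm37Hypotheses) (hG : 𝒢.graph.IsGraph)
    (hNC : ∀ S : Set 𝒢.graph.Vertex, S.Nonempty → ∃ w ∈ S,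
      {b : 𝒢.graph.Branch | 𝒢.graph.abuts b = some w ∧ ∃ b', b' ≠ b ∧ 𝒢.graph.edgeOf b' = 𝒢.graph.edgeOf b ∧
        ∃ w' ∈ S, 𝒢.graph.abuts b' = some w'}.Finite)
    (c : TemperedPiChart 𝒢) {e : 𝒢.graph.Edge} {L : Subgroup c.G} (hL : L ∈ edgeLikeSubgroups c e) {g : c.G}
    (hg : g ∈ Subgroup.Commensurable.commensurator L) : ConjAct.toConjAct g • L = L := by
  rw [Subgroup.Commensurable.commensurator_mem_iff] at hg
  exact eq_of_commensurable_of_mem_edgeLikeSubgroups_of_noCore h37 hG hNC c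
    (conj_mem_edgeLikeSubgroups' c hL g) hL hg

end ProfiniteSemiGraph

/-! ### A rank criterion for «no core» (usability of the class) -/

namespace SemiGraph

universe u'

/-- **RANK CRITERION for «no core».**  If the vertices of `𝔾` carry a rank `ρ : 𝒱 → ℕ` such that every vertex
has only finitely many branches whose edge's other branch abuts a vertex of EQUAL OR HIGHER rank, then every
non-empty set of vertices has a member (one of minimal rank) with finitely many branches toward the set — the
hypothesis `hNC` of this file and of `TemperedHbddOfNoCore.lean`.  (TAME = the ranks «finite valence ↦ 0,
infinite valence ↦ 1»; a vertex joined to infinitely many infinite-valence vertices each with finitely many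
infinite-valence neighbours gets rank `2`; locally finite = any constant rank.) [cite: MochizukiSemiAnbd2006, §1 p.11] -/
theorem noCore_of_rank (G : SemiGraph.{u'}) (ρ : G.Vertex → ℕ)
    (h : ∀ w : G.Vertex, {b : G.Branch | G.abuts b = some w ∧ ∃ b', b' ≠ b ∧ G.edgeOf b' = G.edgeOf b ∧
      ∃ w', G.abuts b' = some w' ∧ ρ w ≤ ρ w'}.Finite) :
    ∀ S : Set G.Vertex, S.Nonempty → ∃ w ∈ S,
      {b : G.Branch | G.abuts b = some w ∧ ∃ b', b' ≠ b ∧ G.edgeOf b' = G.edgeOf b ∧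
        ∃ w' ∈ S, G.abuts b' = some w'}.Finite := by
  classical
  intro S hS
  have hex : ∃ n, ∃ w ∈ S, ρ w = n := by
    obtain ⟨w, hw⟩ := hS
    exact ⟨ρ w, w, hw, rfl⟩
  obtain ⟨w, hw, hρw⟩ := Nat.find_spec hex
  refine ⟨w, hw, (h w).subset ?_⟩
  rintro b ⟨hb, b', hb'b, hb'e, w', hw', hb'w⟩
  refine ⟨hb, b', hb'b, hb'e, w', hb'w, ?_⟩
  rw [hρw]
  exact Nat.find_min' hex ⟨w', hw', rfl⟩

end SemiGraph

end Literature.AnabelianGeometry.SemiGraphs
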